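import Summits.AtomisticToContinuum.FouriersLaw.Theorems.BondHeatUncertaintyBoundedResponseSurvivalSumRuleB
import HarnessLib

/-! # NODE g96 «SurvivalSumRule» — landing part final of 3 (lens-1 g96; bodies byte-identical to node/BondHeatUncertaintyBoundedResponseSurvivalSumRule.lean sha256 57583f39…; see that file's module docstring for the mathematics). -/

noncomputable section

open MeasureTheory ProbabilityTheory Filter Topology Set Function
open scoped NNReal ENNReal
open Literature.MathematicalPhysics.KineticTheory.HeatConduction
open Literature.MathematicalPhysics.KineticTheory OscillatorChain
open Summit.AtomisticToContinuum.FouriersLaw.Theorems.SubdiffusiveBondHeat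
open Summit.AtomisticToContinuum.FouriersLaw.Theorems.OddSectorIrreversibility
open Summit.AtomisticToContinuum.FouriersLaw.Theorems.BoundedResponse.TransientBand

namespace Summit.AtomisticToContinuum.FouriersLaw.Theorems.BoundedResponse.ParityFloor

open Summit.AtomisticToContinuum.FouriersLaw.Theses.BondHeatUncertainty (BoundedResponse)
open Summit.AtomisticToContinuum.FouriersLaw.Theses.GriffithsLimitExchange
  (BoundaryDEP KernelIntegrable FiniteHorizonTransmission PositiveTransmission VanishingSurvival TransmissionLaw)
open Summit.AtomisticToContinuum.FouriersLaw.Theorems.SubdiffusiveBondHeat.EscapeGrading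
  (escapeDeficit OhmicFloor ohmicFloor_iff_boundedResponse)

section SurvivalSumRule

variable {ω₂ lam β γ T : ℝ}

/-! ## §4 Consequences at route level -/

/-- The kernel signs delivered by `BoundaryDEP`: `K_N ≥ 0` and `K̃_N ≥ 0` on `[0,∞)` (definitional unfolding). [formal bookkeeping] -/
theorem kernels_nonneg_of_boundaryDEP (hDEP : BoundaryDEP) {ω₂ lam β γ : ℝ} (hω : 0 < ω₂) (hl : 0 < lam) (hβ : 0 < β)
    (hγ : 0 < γ) {T : ℝ} (hT : 0 < T) (N : ℕ) :
    (∀ u : ℝ, 0 ≤ u → 0 ≤ escapeKernel ω₂ lam β γ T N u) ∧ (∀ u : ℝ, 0 ≤ u → 0 ≤ crossKernel ω₂ lam β γ T N u) := by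
  have h := hDEP ω₂ lam β γ hω hl hβ hγ T hT
  dsimp only at h
  refine ⟨fun u hu => (h N u hu).1, fun u hu => ?_⟩
  rcases Nat.eq_zero_or_pos N with rfl | hN
  · rw [crossKernel, dif_neg (lt_irrefl 0)]
  · have h2 := (h N u hu).2
    rw [dif_pos hN] at h2
    rw [crossKernel_of_pos hN]
    exact h2

/-- The summed sign `K_N + K̃_N ≥ 0` under `BoundaryDEP`. [formal bookkeeping] -/
theorem kernelSum_nonneg_of_boundaryDEP (hDEP : BoundaryDEP) {ω₂ lam β γ : ℝ} (hω : 0 < ω₂) (hl : 0 < lam) (hβ : 0 < β)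
    (hγ : 0 < γ) {T : ℝ} (hT : 0 < T) (N : ℕ) :
    ∀ u : ℝ, 0 ≤ u → 0 ≤ escapeKernel ω₂ lam β γ T N u + crossKernel ω₂ lam β γ T N u := fun u hu =>
  add_nonneg ((kernels_nonneg_of_boundaryDEP hDEP hω hl hβ hγ hT N).1 u hu)
    ((kernels_nonneg_of_boundaryDEP hDEP hω hl hβ hγ hT N).2 u hu)

/-- **(13200) ⟸ (13198): `BoundaryDEP → VanishingSurvival`.**  Under the double-exit positivity the GLE survival crux
holds with `A(ε) = |C_V|/(2γT²ε) + 1`: `N·S_N(A·N²) ≤ N·Var_T(H_N)/(2γT²·A·N²) ≤ |C_V|/(2γT²A) ≤ ε`. [new] -/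
theorem vanishingSurvival_of_boundaryDEP : BoundaryDEP → VanishingSurvival := by
  intro hDEP ω₂ lam β γ hω hl hβ hγ T hT
  show ∀ ε : ℝ, 0 < ε → ∃ A : ℝ, 0 < A ∧
    ∀ᶠ N : ℕ in Filter.atTop, (N : ℝ) * survival ω₂ lam β γ T N (A * (N : ℝ) ^ 2) ≤ ε
  intro ε hε
  obtain ⟨C, hC⟩ := energyFluctuationExtensive_holds ω₂ lam β γ hω hl hβ hγ T hT
  set A : ℝ := |C| / (2 * γ * T ^ 2 * ε) + 1 with hA
  have hA0 : 0 < A := by positivity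
  refine ⟨A, hA0, ?_⟩
  filter_upwards [eventually_ge_atTop 2] with N hN
  have hsum := kernelSum_nonneg_of_boundaryDEP hDEP hω hl hβ hγ hT N
  have hNpos : (0 : ℝ) < N := by exact_mod_cast (show 0 < N by omega)
  have ht : 0 < A * (N : ℝ) ^ 2 := by positivity
  have hV : energyVariance ω₂ lam β γ T N ≤ |C| * N := (hC N).trans (by gcongr; exact le_abs_self C)
  have h1 := survival_le_variance_div hω hl hβ hγ hN hT hsum ht
  have h2 : survival ω₂ lam β γ T N (A * (N : ℝ) ^ 2) ≤ |C| * N / (2 * γ * T ^ 2 * (A * (N : ℝ) ^ 2)) :=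
    h1.trans (by gcongr)
  have e : (N : ℝ) * (|C| * N / (2 * γ * T ^ 2 * (A * (N : ℝ) ^ 2))) = |C| / (2 * γ * T ^ 2 * A) := by
    field_simp
  have hfin : |C| / (2 * γ * T ^ 2 * A) ≤ ε := by
    rw [div_le_iff₀ (by positivity), hA]
    have : ε * (2 * γ * T ^ 2 * (|C| / (2 * γ * T ^ 2 * ε) + 1)) = |C| + 2 * γ * T ^ 2 * ε := by
      field_simp
    rw [this]
    linarith [show 0 < 2 * γ * T ^ 2 * ε by positivity]
  calc (N : ℝ) * survival ω₂ lam β γ T N (A * (N : ℝ) ^ 2)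
      ≤ (N : ℝ) * (|C| * N / (2 * γ * T ^ 2 * (A * (N : ℝ) ^ 2))) := mul_le_mul_of_nonneg_left h2 hNpos.le
    _ = |C| / (2 * γ * T ^ 2 * A) := e
    _ ≤ ε := hfin

/-- **The `GriffithsLimitExchange` assembly with `VanishingSurvival` discharged**:
`BoundaryDEP → FiniteHorizonTransmission → PositiveTransmission → TransmissionLaw` (`KernelIntegrable` and `SandwichGlue`
are proved in the tree). [new] -/
theorem transmissionLaw_of_boundaryDEP :
    BoundaryDEP → FiniteHorizonTransmission → PositiveTransmission → TransmissionLaw := fun hDEP hFH hPT =>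
  sandwichGlue_proof hDEP GriffithsLimitExchange.kernelIntegrable_proof hFH hPT (vanishingSurvival_of_boundaryDEP hDEP)

/-- **(D_S) ⟸ (13198): `BoundaryDEP → StorageBound`** with `C = |C_V|/(2γT²)`, `N₀ = 2`, uniformly in `t ≥ 0`
(no corrector grade needed). [new] -/
theorem storageBound_of_boundaryDEP : BoundaryDEP → StorageBound := by
  intro hDEP ω₂ lam β γ hω hl hβ hγ T hT
  obtain ⟨C, hC⟩ := energyFluctuationExtensive_holds ω₂ lam β γ hω hl hβ hγ T hT
  refine ⟨|C| / (2 * γ * T ^ 2), 2, fun N hN t ht => ?_⟩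
  have hsum := kernelSum_nonneg_of_boundaryDEP hDEP hω hl hβ hγ hT N
  have hV : energyVariance ω₂ lam β γ T N ≤ |C| * N := (hC N).trans (by gcongr; exact le_abs_self C)
  calc storageResponse ω₂ lam β γ T N t ≤ energyVariance ω₂ lam β γ T N / (2 * γ * T ^ 2) :=
        storageResponse_le_variance hω hl hβ hγ hN hT hsum ht
    _ ≤ |C| * N / (2 * γ * T ^ 2) := by gcongr
    _ = |C| / (2 * γ * T ^ 2) * N := by ring

/-- `Ov_N(t) ≤ S^{stor}_N(t)` for `t ≥ 0` (`N ≥ 2`, `K_N, K̃_N ≥ 0`): the escape transient `∫₀ᵗ(1 − θ_N − E_N)` is at most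
`∫₀ᵗ S_N = ∫₀ᵗ(1 − θ_N − φ_N)` since `φ_N ≤ E_N`. [new] -/
theorem escapeTransient_le_storageResponse {ω₂ lam β γ T : ℝ} {N : ℕ} (hω : 0 < ω₂) (hl : 0 < lam) (hβ : 0 < β)
    (hγ : 0 < γ) (hN : 2 ≤ N) (hT : 0 < T)
    (hK : ∀ u : ℝ, 0 ≤ u → 0 ≤ escapeKernel ω₂ lam β γ T N u)
    (hKt : ∀ u : ℝ, 0 ≤ u → 0 ≤ crossKernel ω₂ lam β γ T N u) {t : ℝ} (ht : 0 ≤ t) :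
    escapeTransient ω₂ lam β γ T N t ≤ storageResponse ω₂ lam β γ T N t := by
  have hsum : ∀ u : ℝ, 0 ≤ u → 0 ≤ escapeKernel ω₂ lam β γ T N u + crossKernel ω₂ lam β γ T N u := fun u hu =>
    add_nonneg (hK u hu) (hKt u hu)
  have hKti := integrableOn_crossKernel hω hl hβ hγ hT N
  have hanti := survival_antitoneOn hω hl hβ hγ hT hsum
  have h01 : IntervalIntegrable (survival ω₂ lam β γ T N) volume 0 t :=
    (hanti.mono (by rw [uIcc_of_le ht]; exact Icc_subset_Ici_self)).intervalIntegrable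
  have hθi : IntervalIntegrable (fun s => (1 - stepResponse ω₂ lam β γ T N s) - escapeDeficit ω₂ lam β γ T N)
      volume 0 t :=
    (intervalIntegrable_const.sub ((continuous_stepResponse hω hl hβ hγ hT N).intervalIntegrable 0 t)).sub
      intervalIntegrable_const
  rw [← integral_transient_eq hω hl hβ hγ hT N ht, storageResponse_eq_integral_survival hω hl hβ hγ hN hT ht]
  refine intervalIntegral.integral_mono_on ht hθi h01 fun s hs => ?_
  rw [survival_eq hω hl hβ hγ hN hT hs.1, escapeDeficit_eq_integral_crossKernel hω hl hβ hγ hN hT,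
    intervalIntegral.integral_of_le hs.1]
  have hmono : ∫ u in Ioc 0 s, crossKernel ω₂ lam β γ T N u ≤ ∫ u in Ioi 0, crossKernel ω₂ lam β γ T N u :=
    setIntegral_mono_set hKti ((ae_restrict_iff' measurableSet_Ioi).2 (Eventually.of_forall fun u hu =>
      hKt u (le_of_lt hu))) (Eventually.of_forall Ioc_subset_Ioi_self)
  have hc : 0 ≤ γ / T ^ 2 := by positivity
  nlinarith [mul_le_mul_of_nonneg_left hmono hc]

/-- **(U) ⟸ (13198): `BoundaryDEP → TransientCeilingPoint`** (`Ov_N(N²) ≤ S^{stor}_N(N²) ≤ |C_V|N/(2γT²)`). [new] -/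
theorem transientCeilingPoint_of_boundaryDEP : BoundaryDEP → TransientCeilingPoint := by
  intro hDEP ω₂ lam β γ hω hl hβ hγ T hT
  obtain ⟨C, N₀, hS⟩ := storageBound_of_boundaryDEP hDEP ω₂ lam β γ hω hl hβ hγ T hT
  refine ⟨C, 1, one_pos, max N₀ 2, fun N hN => ?_⟩
  obtain ⟨hK, hKt⟩ := kernels_nonneg_of_boundaryDEP hDEP hω hl hβ hγ hT N
  have ht : (0 : ℝ) ≤ 1 * (N : ℝ) ^ 2 := by positivity
  exact (escapeTransient_le_storageResponse hω hl hβ hγ (le_of_max_le_right hN) hT hK hKt ht).trans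
    (hS N (le_of_max_le_left hN) _ ht)

/-- **DOOR v7: `LeakPoint → BoundaryDEP → BoundedResponse`** — 11071 follows from the far-bath leak estimate (D_F) and the
GLE sign crux 13198 alone (door v6 with its (V) ∧ (C₁) legs replaced by `storageBound_of_boundaryDEP`, and
`TransientFloor 1` by `transientFloor_of_boundaryDEP`). [new] -/
theorem boundedResponse_of_leakPoint_boundaryDEP : LeakPoint → BoundaryDEP → BoundedResponse := fun hF hDEP =>
  boundedResponse_of_leakPoint_storageBound_transientFloor hF (storageBound_of_boundaryDEP hDEP)
    (transientFloor_of_boundaryDEP 1 hDEP)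

/-- **Converse: `BoundedResponse → BoundaryDEP → LeakPoint`** (`F = W − S^{stor} ≤ W`, and `W_N(cN²) ≤ CN` from 11071 ∧ (U)).
So modulo 13198, (D_F) `LeakPoint` is EQUIVALENT to 11071. [new] -/
theorem leakPoint_of_boundedResponse_boundaryDEP : BoundedResponse → BoundaryDEP → LeakPoint := by
  intro hB hDEP ω₂ lam β γ hω hl hβ hγ T hT
  obtain ⟨C, c, hc, N₀, hW⟩ := deficitCesaroPoint_of_ohmicFloor_transientCeiling (ohmicFloor_iff_boundedResponse.mpr hB)
    (transientCeilingPoint_of_boundaryDEP hDEP) ω₂ lam β γ hω hl hβ hγ T hT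
  refine ⟨C, c, hc, max N₀ 2, fun N hN => ?_⟩
  have hN2 : 2 ≤ N := le_of_max_le_right hN
  have hsum := kernelSum_nonneg_of_boundaryDEP hDEP hω hl hβ hγ hT N
  have ht : 0 ≤ c * (N : ℝ) ^ 2 := by positivity
  have hS := storageResponse_nonneg hω hl hβ hγ hN2 hT hsum ht
  have hid := deficitCesaro_eq_storage_add_leak hω hl hβ hγ hN2 hT ht
  linarith [hW N (le_of_max_le_left hN)]

/-- **`LeakPoint ↔ BoundedResponse` given `BoundaryDEP`.** [new] -/
theorem leakPoint_iff_boundedResponse_of_boundaryDEP (hDEP : BoundaryDEP) : LeakPoint ↔ BoundedResponse :=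
  ⟨fun hF => boundedResponse_of_leakPoint_boundaryDEP hF hDEP,
    fun hB => leakPoint_of_boundedResponse_boundaryDEP hB hDEP⟩

/-- **`DeficitCesaroPoint ↔ BoundedResponse` given `BoundaryDEP`.** [new] -/
theorem deficitCesaroPoint_iff_boundedResponse_of_boundaryDEP (hDEP : BoundaryDEP) :
    DeficitCesaroPoint ↔ BoundedResponse :=
  ⟨fun hD => boundedResponse_of_deficitCesaroPoint_boundaryDEP hD hDEP,
    fun hB => deficitCesaroPoint_of_ohmicFloor_transientCeiling (ohmicFloor_iff_boundedResponse.mpr hB)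
      (transientCeilingPoint_of_boundaryDEP hDEP)⟩

/-- **Kernel sandwich, upper half**: `E_N ≤ X_N(t) + S_N(t)` for `t ≥ 0` (`X_N(t) = (γ/T²)∫_{(0,t]} K̃_N`; `K_N, K̃_N ≥ 0`). [folklore] -/
theorem escapeDeficit_le_transmission_add_survival {ω₂ lam β γ T : ℝ} {N : ℕ} (hω : 0 < ω₂) (hl : 0 < lam)
    (hβ : 0 < β) (hγ : 0 < γ) (hN : 2 ≤ N) (hT : 0 < T)
    (hK : ∀ u : ℝ, 0 ≤ u → 0 ≤ escapeKernel ω₂ lam β γ T N u)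
    (hKt : ∀ u : ℝ, 0 ≤ u → 0 ≤ crossKernel ω₂ lam β γ T N u) {t : ℝ} (ht : 0 ≤ t) :
    escapeDeficit ω₂ lam β γ T N ≤
      γ / T ^ 2 * (∫ u in Ioc 0 t, crossKernel ω₂ lam β γ T N u) + survival ω₂ lam β γ T N t := by
  have hs := (SandwichGlue.kernel_sandwich hK hKt (integrableOn_escapeKernel hω hl hβ hγ hT N)
    (integrableOn_crossKernel hω hl hβ hγ hT N) ht).2
  rw [escapeDeficit_eq_integral_crossKernel hω hl hβ hγ hN hT, survival, ← mul_add]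
  exact mul_le_mul_of_nonneg_left hs (by positivity)

/-- **LIMIT-EXCHANGE INEQUALITY**: `E_N ≤ X_N(t) + Var_T(H_N)/(2γT²·t)` for every `t > 0` (`N ≥ 2`, `K_N, K̃_N ≥ 0`) — the
total transmission exceeds the finite-horizon transmission by at most the survival bound. [new] -/
theorem escapeDeficit_le_transmission_add_variance {ω₂ lam β γ T : ℝ} {N : ℕ} (hω : 0 < ω₂) (hl : 0 < lam)
    (hβ : 0 < β) (hγ : 0 < γ) (hN : 2 ≤ N) (hT : 0 < T)
    (hK : ∀ u : ℝ, 0 ≤ u → 0 ≤ escapeKernel ω₂ lam β γ T N u)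
    (hKt : ∀ u : ℝ, 0 ≤ u → 0 ≤ crossKernel ω₂ lam β γ T N u) {t : ℝ} (ht : 0 < t) :
    escapeDeficit ω₂ lam β γ T N ≤
      γ / T ^ 2 * (∫ u in Ioc 0 t, crossKernel ω₂ lam β γ T N u) +
        energyVariance ω₂ lam β γ T N / (2 * γ * T ^ 2 * t) := by
  have hsum : ∀ u : ℝ, 0 ≤ u → 0 ≤ escapeKernel ω₂ lam β γ T N u + crossKernel ω₂ lam β γ T N u := fun u hu =>
    add_nonneg (hK u hu) (hKt u hu)
  linarith [escapeDeficit_le_transmission_add_survival hω hl hβ hγ hN hT hK hKt ht.le,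
    survival_le_variance_div hω hl hβ hγ hN hT hsum ht]

/-- **Finite-horizon transmission bound (FH_bd)** — the *Thouless-horizon reading* of 11071, as a `Prop`: for SOME
horizon constant `A > 0` the end-to-end transmission collected up to the diffusive time `A·N²` is `O(1/N)`:
`∃ A > 0, ∃ C, ∀ᶠ N, N·X_N(A·N²) ≤ C`, `X_N(t) = (γ/T²)∫_{(0,t]} K̃_N`.  As a statement it is weaker than GLE's crux
`FiniteHorizonTransmission` (13199: a limit `N·X_N(A·N²) → x_T(A)` for every `A`) and — modulo the sign crux — it is
*equivalent* to 11071 (`finiteHorizonBound_iff_boundedResponse_of_boundaryDEP`).  Tags: UNDECIDED · ⟸ 13199 ·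
⟺ 11071 ⟺ `LeakPoint` mod 13198. (piece · reading) [route statement · this cell; NOT a literature fact] [new] -/
def FiniteHorizonBound : Prop :=
  ∀ ω₂ lam β γ : ℝ, 0 < ω₂ → 0 < lam → 0 < β → 0 < γ → ∀ T : ℝ, 0 < T →
    ∃ A C : ℝ, 0 < A ∧ ∀ᶠ N : ℕ in atTop,
      (N : ℝ) * (γ / T ^ 2 * ∫ u in Ioc 0 (A * (N : ℝ) ^ 2), crossKernel ω₂ lam β γ T N u) ≤ C

/-- `(13199) ⟹ (FH_bd)` (take `A = 1`, `C = x_T(1) + 1`). [formal bookkeeping] -/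
theorem finiteHorizonBound_of_finiteHorizonTransmission : FiniteHorizonTransmission → FiniteHorizonBound := by
  intro hFH ω₂ lam β γ hω hl hβ hγ T hT
  have h := hFH ω₂ lam β γ hω hl hβ hγ T hT
  dsimp only at h
  obtain ⟨x, hx⟩ := h 1 one_pos
  refine ⟨1, x + 1, one_pos, ?_⟩
  refine (hx.eventually (Iic_mem_nhds (lt_add_one x))).mono fun N hN => ?_
  rcases Nat.eq_zero_or_pos N with rfl | hN0
  · simpa using hN
  · have hN' : (N : ℝ) * (γ / T ^ 2 * ∫ u in Ioc 0 (1 * (N : ℝ) ^ 2),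
        ∫ z, ((z.2 ⟨0, hN0⟩) ^ 2 - T) * (∫ y, ((y.2 ⟨N - 1, by omega⟩) ^ 2 - T)
          ∂((pinnedChain ω₂ lam β γ).transitionKernel N T T u.toNNReal z))
          ∂((pinnedChain ω₂ lam β γ).gibbsMeasure N T)) ≤ x + 1 := by
      simpa only [dif_pos hN0] using hN
    have e : ∀ u, crossKernel ω₂ lam β γ T N u =
        ∫ z, ((z.2 ⟨0, hN0⟩) ^ 2 - T) * (∫ y, ((y.2 ⟨N - 1, by omega⟩) ^ 2 - T)
          ∂((pinnedChain ω₂ lam β γ).transitionKernel N T T u.toNNReal z))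
          ∂((pinnedChain ω₂ lam β γ).gibbsMeasure N T) := fun u => by
      rw [crossKernel_of_pos hN0]
      rfl
    simp only [e]
    exact hN'

/-- `X_N(t) ≤ E_N` for every `t` when `K̃_N ≥ 0` on `[0,∞)` (`N ≥ 2`; exit identity). [folklore] -/
theorem transmission_le_escapeDeficit {ω₂ lam β γ T : ℝ} {N : ℕ} (hω : 0 < ω₂) (hl : 0 < lam) (hβ : 0 < β) (hγ : 0 < γ)
    (hN : 2 ≤ N) (hT : 0 < T) (hKt : ∀ u : ℝ, 0 ≤ u → 0 ≤ crossKernel ω₂ lam β γ T N u) (t : ℝ) :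
    γ / T ^ 2 * (∫ u in Ioc 0 t, crossKernel ω₂ lam β γ T N u) ≤ escapeDeficit ω₂ lam β γ T N := by
  rw [escapeDeficit_eq_integral_crossKernel hω hl hβ hγ hN hT]
  refine mul_le_mul_of_nonneg_left ?_ (by positivity)
  refine setIntegral_mono_set (integrableOn_crossKernel hω hl hβ hγ hT N) ?_ Ioc_subset_Ioi_self.eventuallyLE
  exact (ae_restrict_iff' measurableSet_Ioi).2 (Eventually.of_forall fun u hu => hKt u (le_of_lt hu))

/-- **11071 ⟸ (FH_bd) ∧ (13198).**  If `N·X_N(A·N²) ≤ C₀` eventually, the limit-exchange inequality at `t = A·N²` and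
(V) give `E_N ≤ (C₀ + |C_V|/(2γT²A))/N` for large `N`. [new] -/
theorem boundedResponse_of_finiteHorizonBound_boundaryDEP : FiniteHorizonBound → BoundaryDEP → BoundedResponse := by
  intro hFH hDEP
  refine ohmicFloor_iff_boundedResponse.mp fun ω₂ lam β γ hω hl hβ hγ T hT => ?_
  obtain ⟨A, C₀, hA, hev⟩ := hFH ω₂ lam β γ hω hl hβ hγ T hT
  obtain ⟨C, hC⟩ := energyFluctuationExtensive_holds ω₂ lam β γ hω hl hβ hγ T hT
  obtain ⟨N₁, hN₁⟩ := eventually_atTop.1 hev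
  refine ⟨C₀ + |C| / (2 * γ * T ^ 2 * A), max N₁ 2, fun N hN => ?_⟩
  have hN2 : 2 ≤ N := le_of_max_le_right hN
  obtain ⟨hK, hKt⟩ := kernels_nonneg_of_boundaryDEP hDEP hω hl hβ hγ hT N
  have hNpos : (0 : ℝ) < N := by exact_mod_cast (show 0 < N by omega)
  have ht : (0 : ℝ) < A * (N : ℝ) ^ 2 := by positivity
  have hineq := escapeDeficit_le_transmission_add_variance hω hl hβ hγ hN2 hT hK hKt ht
  have hX : γ / T ^ 2 * ∫ u in Ioc 0 (A * (N : ℝ) ^ 2), crossKernel ω₂ lam β γ T N u ≤ C₀ / N := by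
    rw [le_div_iff₀ hNpos, mul_comm]
    exact hN₁ N (le_of_max_le_left hN)
  have hV : energyVariance ω₂ lam β γ T N ≤ |C| * N := (hC N).trans (by gcongr; exact le_abs_self C)
  calc escapeDeficit ω₂ lam β γ T N
      ≤ C₀ / N + |C| * N / (2 * γ * T ^ 2 * (A * (N : ℝ) ^ 2)) := by
        refine hineq.trans (add_le_add hX ?_)
        gcongr
    _ = (C₀ + |C| / (2 * γ * T ^ 2 * A)) / (N : ℝ) := by
        field_simp

/-- **(FH_bd) ⟸ 11071 ∧ (13198)** (`X_N(t) ≤ E_N ≤ C₁/N`; `A = 1`). [new] -/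
theorem finiteHorizonBound_of_boundedResponse_boundaryDEP : BoundedResponse → BoundaryDEP → FiniteHorizonBound := by
  intro hB hDEP ω₂ lam β γ hω hl hβ hγ T hT
  obtain ⟨C₁, N₀, hE⟩ := ohmicFloor_iff_boundedResponse.mpr hB ω₂ lam β γ hω hl hβ hγ T hT
  refine ⟨1, C₁, one_pos, ?_⟩
  filter_upwards [eventually_ge_atTop (max N₀ 2)] with N hN
  have hN2 : 2 ≤ N := le_of_max_le_right hN
  obtain ⟨-, hKt⟩ := kernels_nonneg_of_boundaryDEP hDEP hω hl hβ hγ hT N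
  have hNpos : (0 : ℝ) < N := by exact_mod_cast (show 0 < N by omega)
  have h1 := transmission_le_escapeDeficit hω hl hβ hγ hN2 hT hKt (1 * (N : ℝ) ^ 2)
  have h2 := hE N (le_of_max_le_left hN)
  calc (N : ℝ) * (γ / T ^ 2 * ∫ u in Ioc 0 (1 * (N : ℝ) ^ 2), crossKernel ω₂ lam β γ T N u)
      ≤ (N : ℝ) * (C₁ / N) := mul_le_mul_of_nonneg_left (h1.trans h2) hNpos.le
    _ = C₁ := by field_simp

/-- **(FH_bd) ⟺ 11071 modulo the sign crux (13198)** — the Thouless-horizon reading made a theorem: under `BoundaryDEP`,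
`N·E_N = O(1)` iff the transmission collected before the diffusive time `N²` is `O(1/N)`. [new] -/
theorem finiteHorizonBound_iff_boundedResponse_of_boundaryDEP (hDEP : BoundaryDEP) :
    FiniteHorizonBound ↔ BoundedResponse :=
  ⟨fun h => boundedResponse_of_finiteHorizonBound_boundaryDEP h hDEP,
    fun h => finiteHorizonBound_of_boundedResponse_boundaryDEP h hDEP⟩

/-- Under the sign crux the three readings of 11071 coincide: `LeakPoint ↔ FiniteHorizonBound`. [new] -/
theorem leakPoint_iff_finiteHorizonBound_of_boundaryDEP (hDEP : BoundaryDEP) : LeakPoint ↔ FiniteHorizonBound :=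
  (leakPoint_iff_boundedResponse_of_boundaryDEP hDEP).trans (finiteHorizonBound_iff_boundedResponse_of_boundaryDEP hDEP).symm

/-- **11071 ⟸ (13199) ∧ (13198): `FiniteHorizonTransmission → BoundaryDEP → BoundedResponse`** — `BoundedResponse`
follows from the two remaining OPEN cruxes of the dormant route `GriffithsLimitExchange` (its `VanishingSurvival` being
discharged by `vanishingSurvival_of_boundaryDEP` and `PositiveTransmission` not needed for the upper bound). [new] -/
theorem boundedResponse_of_finiteHorizonTransmission_boundaryDEP :
    FiniteHorizonTransmission → BoundaryDEP → BoundedResponse := fun hFH hDEP =>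
  boundedResponse_of_finiteHorizonBound_boundaryDEP (finiteHorizonBound_of_finiteHorizonTransmission hFH) hDEP

end SurvivalSumRule

end Summit.AtomisticToContinuum.FouriersLaw.Theorems.BoundedResponse.ParityFloor
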